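import Mathlib
import Summits.ValiantsHypothesis.ValiantsHypothesis.Theorems.NewtonUnitEquationsNewtonTauWeakK3PiRay

/-!
# `NewtonTauWeak` (stmt-ValiantsHypothesis-5904), stub `fixedKCoincidence_t2_K3`: the SHIFTED corner lemma
# (two products at the corner, the third one exactly one ray-step below)

Helper file of the proof of the `K = 3` sub-stub `fixedKCoincidence_t2_K3` of `stub_binomialNewtonTauCommon`
(line `binomial-normal-form`; siege variation "polynomial identity route"), in the word-box language of the
corner model (`…CornerDefs.lean`).  This is the case left open in
`Cruxes/NewtonTauWeak/Lines/binomial-normal-form-ltc.md` §5 ("two products at the corner, the third higher"):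
in the model `⊗A - 1 + a X^{o E_⋆} ⊗B` (`A_e(0) = B_e(0) = 1`, `a ≠ 0`, `o = ord A_⋆` strictly lighter than every
other order point of `A`), an OFF-ray `w`-initial point `v` is `o E_⋆ + k E_b` with `k = ord B_b` for a
direction `b ≠ ⋆` (escape clause: unless that point is on a ray).  Proof: the lightest other order point
`o₂ E_{a₂}` of `A` would be an uncancelled lighter pure point unless the shifted `B`-words undercut it; then the
lightest shifted mixed `B`-word `o E_⋆ + (ord B_b) E_b` is reached by exactly one contributing word, with
coefficient `a [s^{ord}]B_b ≠ 0`.  No definitions. [this line; new]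
-/

set_option linter.dupNamespace false

noncomputable section

open scoped BigOperators Polynomial

namespace Summit.ValiantsHypothesis.ValiantsHypothesis.Theorems.NewtonUnitEquationsNewtonTauWeak

open Summit.ValiantsHypothesis.ValiantsHypothesis.Theorems.NewtonTauWeakCorner

namespace K3Pi

/-- A word with no nonzero letter off `⋆` pushes onto the ray of `⋆`. [folklore] -/
theorem push_of_offstar_zero {s : ℕ} (E : Fin s → Fin 2 → ℤ) (star : Fin s) (n : Fin s → ℕ)
    (h : ∀ e, e ≠ star → n e = 0) : push E n = (n star : ℤ) • E star := by
  classical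
  unfold push
  rw [Finset.sum_eq_single star]
  · intro e _ he; rw [h e he]; simp
  · intro hs; exact absurd (Finset.mem_univ star) hs

/-- **SHIFTED CORNER LEMMA** (`K = 3`, two products at the corner and the third one exactly one ray-step
`o • E_⋆` below; line `binomial-normal-form`, the case "(b)" of `Lines/binomial-normal-form-ltc.md` §5).
Model: `⊗A - 1 + a · X^{o E_⋆} · ⊗B` over directions `E_e` of positive weight (weight injective on `ℤ²`,
pairwise non-parallel rays), `A_e(0) = B_e(0) = 1`, degrees `≤ D`, `a ≠ 0`, `o = ord A_⋆` and the order point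
`o E_⋆` STRICTLY lighter than every other order point of `A`.  The coefficient of a point `z ≠ 0` is
`Σ_{push n = z} sepCoeff A n + a Σ_{o E_⋆ + push n = z} sepCoeff B n`.  If an OFF-ray point `v ≠ 0` has nonzero
coefficient while every lighter nonzero point is cancelled, then `v = o E_⋆ + k E_b` with `k = ord B_b` for some
direction `b ≠ ⋆` — unless that point lies on a ray (escape clause, void under "no short 2-vs-1 relations").
[this line; new] -/
theorem shifted_corner_rigidity {s D : ℕ} (E : Fin s → Fin 2 → ℤ) (w : Fin 2 → ℝ)
    (hw : ∀ e, 0 < wt w (E e)) (hgen : Function.Injective (wt w))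
    (hE : ∀ e e' : Fin s, ∀ k k' : ℕ, 1 ≤ k → (k : ℤ) • E e = (k' : ℤ) • E e' → e = e')
    (A B : Fin s → ℂ[X]) (hA0 : ∀ e, (A e).coeff 0 = 1) (hB0 : ∀ e, (B e).coeff 0 = 1)
    (hAD : ∀ e, (A e).natDegree ≤ D) (hBD : ∀ e, (B e).natDegree ≤ D)
    (a : ℂ) (ha : a ≠ 0) (star : Fin s) (o : ℕ) (ho : IsOrder (A star) o)
    (hstar : ∀ e, e ≠ star → ∀ k, IsOrder (A e) k → (o : ℝ) * wt w (E star) < (k : ℝ) * wt w (E e))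
    (v : Fin 2 → ℤ) (hv0 : v ≠ 0) (hoff : ¬ OnRay E v)
    (hv : (∑ n ∈ (box s D).filter (fun n => push E n = v), sepCoeff A n) +
        a * (∑ n ∈ (box s D).filter (fun n => (o : ℤ) • E star + push E n = v), sepCoeff B n) ≠ 0)
    (hcanc : ∀ z, z ≠ 0 → wt w z < wt w v →
      (∑ n ∈ (box s D).filter (fun n => push E n = z), sepCoeff A n) +
        a * (∑ n ∈ (box s D).filter (fun n => (o : ℤ) • E star + push E n = z), sepCoeff B n) = 0) :
    ∃ b, b ≠ star ∧ ∃ k, IsOrder (B b) k ∧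
      (v = (o : ℤ) • E star + (k : ℤ) • E b ∨ OnRay E ((o : ℤ) • E star + (k : ℤ) • E b)) := by
  classical
  -- orders by choice
  let oA : Fin s → ℕ := fun e => if h : Active (A e) then Classical.choose (exists_isOrder h) else 0
  let oB : Fin s → ℕ := fun e => if h : Active (B e) then Classical.choose (exists_isOrder h) else 0
  have hoA : ∀ e, Active (A e) → IsOrder (A e) (oA e) := by
    intro e h; simp only [oA, dif_pos h]; exact Classical.choose_spec (exists_isOrder h)
  have hoB : ∀ e, Active (B e) → IsOrder (B e) (oB e) := by
    intro e h; simp only [oB, dif_pos h]; exact Classical.choose_spec (exists_isOrder h)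
  have hAstar : Active (A star) := ⟨o, ho.1, ho.2.1⟩
  have hoAstar : oA star = o := (hoA star hAstar).unique ho
  set ωs : ℝ := (o : ℝ) * wt w (E star) with hωs
  have hωs_pos : 0 < ωs := mul_pos (by exact_mod_cast ho.1) (hw star)
  -- the off-star active directions of `A` and of `B`
  set AA := Finset.univ.filter fun e => e ≠ star ∧ Active (A e) with hAAdef
  set BB := Finset.univ.filter fun e => e ≠ star ∧ Active (B e) with hBBdef
  -- second lightest order direction of `A` (junk `star` if none) and lightest off-star order direction of `B`
  have hexA : ∃ a₂, (AA.Nonempty → a₂ ∈ AA ∧ ∀ e ∈ AA, (oA a₂ : ℝ) * wt w (E a₂) ≤ (oA e : ℝ) * wt w (E e)) := by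
    by_cases hne : AA.Nonempty
    · obtain ⟨a₂, ha₂, hmin⟩ := AA.exists_min_image (fun e => (oA e : ℝ) * wt w (E e)) hne
      exact ⟨a₂, fun _ => ⟨ha₂, hmin⟩⟩
    · exact ⟨star, fun h => absurd h hne⟩
  obtain ⟨a₂, ha₂spec⟩ := hexA
  have hexB : ∃ b, (BB.Nonempty → b ∈ BB ∧ ∀ e ∈ BB, (oB b : ℝ) * wt w (E b) ≤ (oB e : ℝ) * wt w (E e)) := by
    by_cases hne : BB.Nonempty
    · obtain ⟨b, hb, hmin⟩ := BB.exists_min_image (fun e => (oB e : ℝ) * wt w (E e)) hne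
      exact ⟨b, fun _ => ⟨hb, hmin⟩⟩
    · exact ⟨star, fun h => absurd h hne⟩
  obtain ⟨b, hbspec⟩ := hexB
  set θ₂ : ℝ := (oA a₂ : ℝ) * wt w (E a₂) with hθ₂
  set ΘA : ℝ := ωs + θ₂ with hΘA
  set ΘB : ℝ := ωs + (oB b : ℝ) * wt w (E b) with hΘB
  have hmemAA : ∀ e, e ∈ AA ↔ e ≠ star ∧ Active (A e) := fun e => by simp [hAAdef]
  have hmemBB : ∀ e, e ∈ BB ↔ e ≠ star ∧ Active (B e) := fun e => by simp [hBBdef]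
  -- (W_A) mixed `A`-words weigh at least `ΘA`
  have hWA : ∀ n : Fin s → ℕ, 2 ≤ (Finset.univ.filter fun x => n x ≠ 0).card → sepCoeff A n ≠ 0 →
      AA.Nonempty ∧ ΘA ≤ wt w (push E n) := by
    intro n h2 hsc
    -- an off-star nonzero letter
    obtain ⟨e₀, he₀, hne₀⟩ : ∃ e₀, e₀ ≠ star ∧ n e₀ ≠ 0 := by
      by_contra hall
      push Not at hall
      have hsub : (Finset.univ.filter fun x => n x ≠ 0) ⊆ {star} := by
        intro x hx
        rw [Finset.mem_singleton]
        by_contra hxs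
        exact (Finset.mem_filter.mp hx).2 (hall x hxs)
      have := Finset.card_le_card hsub
      rw [Finset.card_singleton] at this
      omega
    have hact₀ : Active (A e₀) :=
      active_of_coeff_ne_zero (Nat.one_le_iff_ne_zero.mpr hne₀) (sepCoeff_ne_zero_apply hsc e₀)
    have hAAne : AA.Nonempty := ⟨e₀, (hmemAA e₀).mpr ⟨he₀, hact₀⟩⟩
    obtain ⟨ha₂, ha₂min⟩ := ha₂spec hAAne
    obtain ⟨ha₂ne, ha₂act⟩ := (hmemAA a₂).mp ha₂
    have h1min : ∀ e, Active (A e) → (oA star : ℝ) * wt w (E star) ≤ (oA e : ℝ) * wt w (E e) := by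
      intro e he
      rw [hoAstar]
      by_cases hes : e = star
      · subst hes; rw [hoAstar]
      · exact (hstar e hes (oA e) (hoA e he)).le
    have h2min : ∀ e, e ≠ star → Active (A e) → (oA a₂ : ℝ) * wt w (E a₂) ≤ (oA e : ℝ) * wt w (E e) :=
      fun e hes he => ha₂min e ((hmemAA e).mpr ⟨hes, he⟩)
    have := (weight_ge_two_lightest E w hw hgen hE A oA hoA star a₂ (Ne.symm ha₂ne) ha₂act h1min h2min
      n h2 hsc).1
    rw [hoAstar] at this
    exact ⟨hAAne, this⟩
  -- (W_B) `B`-words with an off-star letter weigh (after the shift) at least `ΘB`, equality for one word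
  have hWB : ∀ n : Fin s → ℕ, sepCoeff B n ≠ 0 → ∀ e₀, e₀ ≠ star → n e₀ ≠ 0 →
      BB.Nonempty ∧ ΘB ≤ wt w ((o : ℤ) • E star + push E n) ∧
        (ΘB = wt w ((o : ℤ) • E star + push E n) → n = Pi.single b (oB b)) := by
    intro n hsc e₀ he₀ hne₀
    have hact₀ : Active (B e₀) :=
      active_of_coeff_ne_zero (Nat.one_le_iff_ne_zero.mpr hne₀) (sepCoeff_ne_zero_apply hsc e₀)
    have hBBne : BB.Nonempty := ⟨e₀, (hmemBB e₀).mpr ⟨he₀, hact₀⟩⟩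
    obtain ⟨hb, hbmin⟩ := hbspec hBBne
    obtain ⟨-, hbact⟩ := (hmemBB b).mp hb
    have hbmin' : ∀ e, e ≠ star → Active (B e) → (oB b : ℝ) * wt w (E b) ≤ (oB e : ℝ) * wt w (E e) :=
      fun e hes he => hbmin e ((hmemBB e).mpr ⟨hes, he⟩)
    have hh := weight_ge_lightest_offstar E w hw hgen hE B oB hoB star b hbact hbmin' n hsc e₀ he₀ hne₀
    have hwt : wt w ((o : ℤ) • E star + push E n) = ωs + wt w (push E n) := by
      rw [wt_add, wt_zsmul]; push_cast; ring
    refine ⟨hBBne, by rw [hwt, hΘB]; linarith [hh.1], fun heq => hh.2 ?_⟩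
    rw [hwt, hΘB] at heq
    linarith
  -- a contributing word at `v`
  have hcontrib : (AA.Nonempty ∧ ΘA ≤ wt w v) ∨ (BB.Nonempty ∧ ΘB ≤ wt w v) := by
    by_cases hAv : (∑ n ∈ (box s D).filter (fun n => push E n = v), sepCoeff A n) = 0
    · rw [hAv, zero_add] at hv
      have hBv := right_ne_zero_of_mul hv
      obtain ⟨n, hn, hsc⟩ := Finset.exists_ne_zero_of_sum_ne_zero hBv
      have hpush : (o : ℤ) • E star + push E n = v := (Finset.mem_filter.mp hn).2
      -- `n` has an off-star letter, else `v` is on the ray of `star`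
      obtain ⟨e₀, he₀, hne₀⟩ : ∃ e₀, e₀ ≠ star ∧ n e₀ ≠ 0 := by
        by_contra hall
        push Not at hall
        apply hoff
        refine ⟨star, o + n star, by have := ho.1; omega, ?_⟩
        rw [← hpush, push_of_offstar_zero E star n hall, ← add_smul]
        norm_cast
      right
      have := hWB n hsc e₀ he₀ hne₀
      rw [hpush] at this
      exact ⟨this.1, this.2.1⟩
    · obtain ⟨n, hn, hsc⟩ := Finset.exists_ne_zero_of_sum_ne_zero hAv
      have hpush : push E n = v := (Finset.mem_filter.mp hn).2
      have h2 := two_le_card_of_offRay E hpush hv0 hoff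
      left
      have := hWA n h2 hsc
      rw [hpush] at this
      exact this
  -- the pure point `r₂ = oA a₂ • E a₂` survives when the shifted mixed `B`-words are heavier than it
  have hr₂ : AA.Nonempty → (BB.Nonempty → θ₂ < ΘB) → θ₂ < wt w v → False := by
    intro hAAne hBcond hlt
    obtain ⟨ha₂, -⟩ := ha₂spec hAAne
    obtain ⟨ha₂ne, ha₂act⟩ := (hmemAA a₂).mp ha₂
    have hoa₂ := hoA a₂ ha₂act
    set r₂ : Fin 2 → ℤ := (oA a₂ : ℤ) • E a₂ with hr₂def
    have hwr₂ : wt w r₂ = θ₂ := by rw [hr₂def, wt_zsmul]; push_cast; ring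
    have hθ₂pos : 0 < θ₂ := mul_pos (by exact_mod_cast hoa₂.1) (hw a₂)
    have hr₂0 : r₂ ≠ 0 := by
      intro h; have := congrArg (wt w) h; rw [hwr₂, wt_zero] at this; linarith
    -- the `A`-part at `r₂` is the pure coefficient
    have hApart : (∑ n ∈ (box s D).filter (fun n => push E n = r₂), sepCoeff A n) = (A a₂).coeff (oA a₂) := by
      rw [Finset.sum_eq_single_of_mem (Pi.single a₂ (oA a₂))]
      · exact sepCoeff_single A hA0 a₂ (oA a₂)
      · exact Finset.mem_filter.mpr ⟨single_mem_box a₂ (hoa₂.le_natDegree.trans (hAD a₂)),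
          by rw [push_single]⟩
      · intro n hn hns
        by_contra hsc
        have hpush : push E n = r₂ := (Finset.mem_filter.mp hn).2
        by_cases h2 : 2 ≤ (Finset.univ.filter fun x => n x ≠ 0).card
        · have := (hWA n h2 hsc).2
          rw [hpush, hwr₂, hΘA] at this
          linarith
        · rcases eq_zero_or_single_of_card_le_one n (by omega) with h0 | ⟨e, k, hk, hnek⟩
          · rw [h0, push_zero] at hpush; exact hr₂0 hpush.symm
          · rw [hnek, push_single] at hpush
            have hkr : (k : ℝ) * wt w (E e) = (oA a₂ : ℝ) * wt w (E a₂) := by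
              have := congrArg (wt w) hpush
              rw [wt_zsmul, wt_zsmul] at this; push_cast at this; exact this
            obtain ⟨hea, hko⟩ := eq_of_wt_smul_eq E w hw hgen hE hk hkr
            subst hea
            exact hns (by rw [hnek, hko])
    -- the `B`-part at `r₂` vanishes
    have hBpart : (∑ n ∈ (box s D).filter (fun n => (o : ℤ) • E star + push E n = r₂), sepCoeff B n) = 0 := by
      refine Finset.sum_eq_zero fun n hn => ?_
      by_contra hsc
      have hpush : (o : ℤ) • E star + push E n = r₂ := (Finset.mem_filter.mp hn).2
      by_cases hall : ∀ e, e ≠ star → n e = 0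
      · rw [push_of_offstar_zero E star n hall, ← add_smul] at hpush
        have h1 : 1 ≤ o + n star := by have := ho.1; omega
        have : star = a₂ := hE star a₂ (o + n star) (oA a₂) h1 (by push_cast; exact hpush.trans hr₂def)
        exact ha₂ne this.symm
      · push Not at hall
        obtain ⟨e₀, he₀, hne₀⟩ := hall
        have hh := hWB n hsc e₀ he₀ hne₀
        have := hBcond hh.1
        rw [hpush, hwr₂] at hh
        linarith [hh.2.1]
    have hval := hcanc r₂ hr₂0 (by rw [hwr₂]; exact hlt)
    rw [hApart, hBpart, mul_zero, add_zero] at hval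
    exact hoa₂.2.1 hval
  -- Step 1: `B` has an off-star active direction
  have hBBne : BB.Nonempty := by
    by_contra hBBe
    rcases hcontrib with ⟨hAAne, hle⟩ | ⟨hBBne, -⟩
    · refine hr₂ hAAne (fun h => absurd h hBBe) ?_
      have : θ₂ < ΘA := by rw [hΘA]; linarith
      linarith
    · exact hBBe hBBne
  obtain ⟨hb, -⟩ := hbspec hBBne
  obtain ⟨hbne, hbact⟩ := (hmemBB b).mp hb
  have hob := hoB b hbact
  -- the candidate point
  set q : Fin 2 → ℤ := (o : ℤ) • E star + (oB b : ℤ) • E b with hqdef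
  have hwq : wt w q = ΘB := by rw [hqdef, hΘB, wt_add, wt_zsmul, wt_zsmul]; push_cast; ring
  have hΘBpos : 0 < ΘB := by
    rw [hΘB]; exact add_pos hωs_pos (mul_pos (by exact_mod_cast hob.1) (hw b))
  have hq0 : q ≠ 0 := by
    intro h; have := congrArg (wt w) h; rw [hwq, wt_zero] at this; linarith
  refine ⟨b, hbne, oB b, hob, ?_⟩
  by_cases hray : OnRay E q
  · exact Or.inr hray
  left
  -- Step 2: mixed `A`-words are heavier than `q`
  have hAheavy : AA.Nonempty → ΘB < ΘA := by
    intro hAAne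
    by_contra hle
    push Not at hle
    have hθ₂lt : θ₂ < ΘA := by rw [hΘA]; linarith
    refine hr₂ hAAne (fun _ => by linarith) ?_
    rcases hcontrib with ⟨-, h⟩ | ⟨-, h⟩ <;> linarith
  -- Step 3: the coefficient at `q`
  have hApart : (∑ n ∈ (box s D).filter (fun n => push E n = q), sepCoeff A n) = 0 := by
    refine Finset.sum_eq_zero fun n hn => ?_
    by_contra hsc
    have hpush : push E n = q := (Finset.mem_filter.mp hn).2
    have h2 := two_le_card_of_offRay E hpush hq0 hray
    have hh := hWA n h2 hsc
    have := hAheavy hh.1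
    rw [hpush, hwq] at hh
    linarith [hh.2]
  have hBpart : (∑ n ∈ (box s D).filter (fun n => (o : ℤ) • E star + push E n = q), sepCoeff B n) =
      (B b).coeff (oB b) := by
    rw [Finset.sum_eq_single_of_mem (Pi.single b (oB b))]
    · exact sepCoeff_single B hB0 b (oB b)
    · exact Finset.mem_filter.mpr ⟨single_mem_box b (hob.le_natDegree.trans (hBD b)), by rw [push_single]⟩
    · intro n hn hns
      by_contra hsc
      have hpush : (o : ℤ) • E star + push E n = q := (Finset.mem_filter.mp hn).2
      by_cases hall : ∀ e, e ≠ star → n e = 0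
      · apply hray
        refine ⟨star, o + n star, by have := ho.1; omega, ?_⟩
        rw [← hpush, push_of_offstar_zero E star n hall, ← add_smul]
        norm_cast
      · push Not at hall
        obtain ⟨e₀, he₀, hne₀⟩ := hall
        have hh := hWB n hsc e₀ he₀ hne₀
        rw [hpush, hwq] at hh
        exact hns (hh.2.2 rfl)
  -- Step 4: `v = q`
  have hqle : wt w q ≤ wt w v := by
    rw [hwq]
    rcases hcontrib with ⟨hAAne, h⟩ | ⟨-, h⟩
    · have := hAheavy hAAne; linarith
    · exact h
  rcases lt_or_eq_of_le hqle with hlt | heq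
  · have hval := hcanc q hq0 hlt
    rw [hApart, hBpart, zero_add] at hval
    exact absurd hval (mul_ne_zero ha hob.2.1)
  · exact (hgen heq).symm ▸ rfl

end K3Pi

end Summit.ValiantsHypothesis.ValiantsHypothesis.Theorems.NewtonUnitEquationsNewtonTauWeak

end
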